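import Summits.AtomisticToContinuum.Crystallization.Theorems.FreeSplittingCertificatesStrictSplittingRuleP1CellMoments2

/-!
# `StrictSplittingRule` (stmt-AtomisticToContinuum-12560): TRANSPORT of corner-simplex integrals to every reference piece and every real cell; second moments of the cells `≤ |cell|/16` (P1 interpolant object, part 22)

Route `FreeSplittingCertificates`, crux r3 `StrictSplittingRule` (H12⋆ = `stub_coreJointCoercive`), unit b2b-freesplit-B gen 22.
VALUE = bookkeeping for the DEMAND side of the transfer (item (2''') of HOME FAR-LEMMA-SPEC §17 (c)(B),(e)): generic transport lemmas
(`setIntegral_p1RefCell_transport`: `∫_{piece (e,π)} g = ∫_K g ∘ p1RefMap`; `setIntegral_p1RealCell_transport`: `∫_{cell} g(c + L y) dy =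
(√3a²h/2)·∫_{piece} g`) and, with parts 20–21, the MIXED SECOND MOMENTS OF EVERY REAL CELL:
**`setIntegral_p1Bary_mul_p1RealCell_le`**: `∫_{cell (n,π)} λ_m(T⁻¹y − n)·λ_{m'}(T⁻¹y − n) dy ≤ √3a²h/192 = |cell|/16` for `m ≠ m'` — the constant in the
vertex-quadrature excess `(|T|/4)Σ_i f_i² − ∫_T f² = Σ_{i<j}(f_i−f_j)²∫_Tλ_iλ_j ≤ (|T|/16)Σ_{i<j}(f_i−f_j)²` that charges the bare radial deficit of
the lattice to gradient energy.  NOT a proof of H12⋆, NOT summit progress.  [folklore]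
-/

noncomputable section

open Set Function Metric MeasureTheory Filter Topology
open scoped BigOperators NNReal ENNReal

namespace Summit.AtomisticToContinuum.Crystallization.Theorems.StrictSplittingRuleBirth

/-! ## Transport: corner simplex → reference piece -/

/-- **Transport to a reference piece**: if `g (p1RefMap e π p) = g' p` and `g` is integrable on the piece, then `∫_{piece} g = ∫_K g'`. -/
theorem setIntegral_p1RefCell_transport (e : Bool) (π : Fin 6) {g g' : (Fin 3 → ℝ) → ℝ} (hg : ∀ p, g (p1RefMap e π p) = g' p)
    (hgi : IntegrableOn g (p1RefCell e π) volume) :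
    ∫ q in p1RefCell e π, g q = ∫ p in p1RefCell true 0, g' p := by
  have hmeas : MeasurableSet (p1RefCell e π) := (isClosed_p1RefCell e π).measurableSet
  have hmeas0 : MeasurableSet (p1RefCell true 0) := (isClosed_p1RefCell true 0).measurableSet
  rw [← integral_indicator hmeas, ← integral_indicator hmeas0]
  have hind : (fun p => (p1RefCell true 0).indicator g' p) = fun p => ((p1RefCell e π).indicator g) (p1RefMap e π p) := by
    funext p
    by_cases hp : p ∈ p1RefCell true 0
    · rw [indicator_of_mem hp, indicator_of_mem ((p1RefMap_mem_iff e π p).2 hp), hg]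
    · rw [indicator_of_notMem hp, indicator_of_notMem (fun h => hp ((p1RefMap_mem_iff e π p).1 h))]
  rw [hind]
  have hMP := measurePreserving_p1RefMap e π
  have hf : AEStronglyMeasurable ((p1RefCell e π).indicator g) (Measure.map (p1RefMap e π) volume) := by
    rw [hMP.map_eq]
    exact (hgi.integrable_indicator hmeas).aestronglyMeasurable
  rw [← integral_map hMP.measurable.aemeasurable hf, hMP.map_eq]

/-- Products of barycentric coordinates are integrable on every reference piece. -/
theorem integrableOn_p1Bary_mul (e : Bool) (π : Fin 6) (m m' : Fin 4) (e' : Bool) (π' : Fin 6) :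
    IntegrableOn (fun p => p1Bary e π m p * p1Bary e π m' p) (p1RefCell e' π') volume := by
  have hK : IsCompact (p1RefCell e' π') := by
    refine (isCompact_Icc (a := (0 : Fin 3 → ℝ)) (b := 1)).of_isClosed_subset (isClosed_p1RefCell e' π') fun p hp => ?_
    exact ⟨fun i => (p1RefCell_subset_cube hp i).1, fun i => (p1RefCell_subset_cube hp i).2⟩
  have hc : Continuous fun p : Fin 3 → ℝ => p1Bary e π m p * p1Bary e π m' p := by unfold p1Bary; fun_prop
  exact hc.continuousOn.integrableOn_compact hK

/-- **Mixed second moments of every reference piece are at most `1/96`.** -/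
theorem setIntegral_p1Bary_mul_p1RefCell_le (e : Bool) (π : Fin 6) {m m' : Fin 4} (hne : m ≠ m') :
    ∫ q in p1RefCell e π, p1Bary e π m q * p1Bary e π m' q ≤ 1 / 96 := by
  rw [setIntegral_p1RefCell_transport e π (g := fun q => p1Bary e π m q * p1Bary e π m' q) (g' := fun p => p1Bary true 0 m p * p1Bary true 0 m' p)
    (fun p => by simp only [p1Bary_p1RefMap]) (integrableOn_p1Bary_mul e π m m' e π)]
  exact setIntegral_p1Bary_mul_corner_le hne

/-! ## Transport: reference piece → real cell -/

/-- **Transport to a real cell**: for a measurable `g`, integrable on the reference piece of cell `i = (n,π)`,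
`∫_{cell i} g((c + L y)) dy = (√3·a²·h/2) · ∫_{piece} g`, where `T⁻¹ y − p1Vec n = c + L y` on the cell's slab
(`c = p1ChartInvAff a h n.1 0 − p1Vec n`, `L = p1ChartInvCLM a h n.1`). -/
theorem setIntegral_p1RealCell_transport {a h : ℝ} (ha : 0 < a) (hh : 0 < h) (i : (ℤ × ℤ × ℤ) × Fin 6) {g : (Fin 3 → ℝ) → ℝ}
    (hgm : Measurable g) :
    ∫ y in p1RealCell a h i, g ((p1ChartInvAff a h i.1.1 0 - p1Vec i.1) + p1ChartInvCLM a h i.1.1 y) =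
      (√3 * a ^ 2 * h / 2) * ∫ q in p1RefCell (p1Par i.1) i.2, g q := by
  set c : Fin 3 → ℝ := p1ChartInvAff a h i.1.1 0 - p1Vec i.1 with hc
  set Lℓ : (Fin 3 → ℝ) →ₗ[ℝ] (Fin 3 → ℝ) := ((p1ChartInvCLM a h i.1.1 : (Fin 3 → ℝ) →L[ℝ] (Fin 3 → ℝ)) : (Fin 3 → ℝ) →ₗ[ℝ] (Fin 3 → ℝ))
    with hL
  have h3 : 0 < √3 := Real.sqrt_pos.2 (by norm_num)
  have hdet : LinearMap.det Lℓ = 2 / (√3 * a ^ 2 * h) := det_p1ChartInvCLM a h i.1.1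
  have hdet0 : LinearMap.det Lℓ ≠ 0 := by rw [hdet]; positivity
  have hmeasR : MeasurableSet (p1RefCell (p1Par i.1) i.2) := (isClosed_p1RefCell _ _).measurableSet
  have hmeasS : MeasurableSet ((fun q => c + q) ⁻¹' p1RefCell (p1Par i.1) i.2) :=
    hmeasR.preimage (continuous_const.add continuous_id).measurable
  have hmeasC : MeasurableSet (p1RealCell a h i) := (isClosed_p1RealCell a h i).measurableSet
  set G : (Fin 3 → ℝ) → ℝ := ((fun q => c + q) ⁻¹' p1RefCell (p1Par i.1) i.2).indicator fun z => g (c + z) with hG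
  have hGm : Measurable G := Measurable.indicator (hgm.comp (measurable_const.add measurable_id)) hmeasS
  have hcell : p1RealCell a h i = Lℓ ⁻¹' ((fun q => c + q) ⁻¹' p1RefCell (p1Par i.1) i.2) := p1RealCell_eq_preimage a h i
  have step1 : ∫ y in p1RealCell a h i, g (c + p1ChartInvCLM a h i.1.1 y) = ∫ y, G (Lℓ y) := by
    rw [← integral_indicator hmeasC]
    congr 1
    funext y
    rw [hcell]
    by_cases hy : Lℓ y ∈ (fun q => c + q) ⁻¹' p1RefCell (p1Par i.1) i.2
    · rw [indicator_of_mem (mem_preimage.2 hy), hG, indicator_of_mem hy]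
      rfl
    · rw [indicator_of_notMem (fun h' => hy (mem_preimage.1 h')), hG, indicator_of_notMem hy]
  have step2 : ∫ y, G (Lℓ y) = (√3 * a ^ 2 * h / 2) * ∫ z, G z := by
    have hmap := Measure.map_linearMap_addHaar_eq_smul_addHaar volume hdet0
    have hf : AEStronglyMeasurable G (Measure.map Lℓ volume) := hGm.aestronglyMeasurable
    rw [← integral_map (Lℓ.continuous_of_finiteDimensional.measurable.aemeasurable) hf, hmap, integral_smul_measure, hdet,
      inv_div, abs_of_pos (by positivity), ENNReal.toReal_ofReal (by positivity), smul_eq_mul]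
  have step3 : ∫ z, G z = ∫ q in p1RefCell (p1Par i.1) i.2, g q := by
    have e : G = fun z => ((p1RefCell (p1Par i.1) i.2).indicator g) (c + z) := by
      funext z
      by_cases hz : c + z ∈ p1RefCell (p1Par i.1) i.2
      · rw [hG, indicator_of_mem (mem_preimage.2 hz), indicator_of_mem hz]
      · rw [hG, indicator_of_notMem (fun h' => hz (mem_preimage.1 h')), indicator_of_notMem hz]
    rw [e, integral_add_left_eq_self (fun w => (p1RefCell (p1Par i.1) i.2).indicator g w) c, integral_indicator hmeasR]
  rw [step1, step2, step3]

/-- **Mixed second moments of every real cell: `∫_{cell} λ_m λ_{m'} ≤ √3·a²·h/192 = |cell|/16`** (`m ≠ m'`; hat functions of two distinct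
vertices of the cell, `p1Hat_vert`).  NOT a proof of H12⋆, NOT summit progress. -/
theorem setIntegral_p1Bary_mul_p1RealCell_le {a h : ℝ} (ha : 0 < a) (hh : 0 < h) (i : (ℤ × ℤ × ℤ) × Fin 6) {m m' : Fin 4} (hne : m ≠ m') :
    ∫ y in p1RealCell a h i, p1Bary (p1Par i.1) i.2 m (p1ChartInv a h y - p1Vec i.1) * p1Bary (p1Par i.1) i.2 m' (p1ChartInv a h y - p1Vec i.1) ≤
      √3 * a ^ 2 * h / 192 := by
  have h3 : 0 < √3 := Real.sqrt_pos.2 (by norm_num)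
  have hg : Measurable fun q : Fin 3 → ℝ => p1Bary (p1Par i.1) i.2 m q * p1Bary (p1Par i.1) i.2 m' q := by
    have : Continuous fun q : Fin 3 → ℝ => p1Bary (p1Par i.1) i.2 m q * p1Bary (p1Par i.1) i.2 m' q := by unfold p1Bary; fun_prop
    exact this.measurable
  have key := setIntegral_p1RealCell_transport ha hh i hg
  have haff : ∫ y in p1RealCell a h i, p1Bary (p1Par i.1) i.2 m (p1ChartInv a h y - p1Vec i.1) * p1Bary (p1Par i.1) i.2 m' (p1ChartInv a h y - p1Vec i.1) =
      ∫ y in p1RealCell a h i, (fun q => p1Bary (p1Par i.1) i.2 m q * p1Bary (p1Par i.1) i.2 m' q)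
        ((p1ChartInvAff a h i.1.1 0 - p1Vec i.1) + p1ChartInvCLM a h i.1.1 y) := by
    refine setIntegral_congr_fun (isClosed_p1RealCell a h i).measurableSet fun y hy => ?_
    have hs := p1RealCell_slab hy
    simp only [p1ChartInv_eq_clm a h i.1.1 hs.1 hs.2]
    congr 2 <;> abel
  rw [haff, key]
  have hb := setIntegral_p1Bary_mul_p1RefCell_le (p1Par i.1) i.2 hne
  have hpos : 0 < √3 * a ^ 2 * h / 2 := by positivity
  calc √3 * a ^ 2 * h / 2 * ∫ q in p1RefCell (p1Par i.1) i.2, p1Bary (p1Par i.1) i.2 m q * p1Bary (p1Par i.1) i.2 m' q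
      ≤ √3 * a ^ 2 * h / 2 * (1 / 96) := mul_le_mul_of_nonneg_left hb hpos.le
    _ = √3 * a ^ 2 * h / 192 := by ring

end Summit.AtomisticToContinuum.Crystallization.Theorems.StrictSplittingRuleBirth
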